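import Summits.PneNP.PneNP.Theorems.SymmetryBudgetWindowCanoniserSemState

/-!
# Window canoniser, XIV: gate semantics of the replay — cells, the branching cell, selection, section move

Route `PneNP/SymmetryBudget`, dichotomy `WindowBarrier` (stmt-PneNP-2145) / `NoHiddenOrder` (stmt-PneNP-14781);
continuation of `…WindowCanoniserSemState.lean`.  Under `WCan.Corr L x it S` (and a window of at least two
vertices, which the padded counter of `big` needs): `szGE v w` compares lifted cell sizes, `big v` tests
`2 ≤ |cell v|`, **`bmc v ↔ v ∈ CGCanon.bigMinCell W c`** (the branching cell of the tree's canoniser),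
`sel v ↔ v ∈ WCan.selSet` (the selected vertex), `hasSel`, `pok ↔ WCan.pokP`, `nWs v ↔ v ∈ WCan.secW`.
-/

-- `Summit.PneNP.PneNP.…` duplicates `PneNP` BY DESIGN (single-problem summit, D-0017 layout).
set_option linter.dupNamespace false

noncomputable section

namespace Summit.PneNP.PneNP.Theorems

namespace WCan

open Finset Literature.Computability.Complexity Literature.Computability.Complexity.CGCanon
  Literature.Combinatorics.SimpleGraph
open scoped Classical

variable {K r n : ℕ} [NeZero n] {L : Lab K n} {x : Fin (r + n) × Fin (r + n) → Bool} {it : Fin (T n + 1)} {S : St n}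
  (h : Corr L x it S)
include h

/-! ### Cell sizes -/

/-- `szGE v w` computes `|lcell w| ≤ |lcell v|`. -/
theorem ev_aSzGE (v w : Fin n) : ev x (aSzGE (r := r) L it v w) = decide ((lcell S w).card ≤ (lcell S v).card) := by
  apply Bool.eq_iff_iff.2
  show Vl K x _ = true ↔ _
  rw [Vl_eq, decide_eq_true_iff]
  show decide (n + n ≤ 2 * GateFn.numOnes (fun i : Fin (n + n) => GateDAG.wire x (Vl K x)
    (Fin.append (fun y => w1 (WEF L it v y)) (fun y => w1 (nWEF L it w y)) i))) = true ↔ _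
  rw [decide_eq_true_iff]
  have happ : (fun i : Fin (n + n) => GateDAG.wire x (Vl K x) (Fin.append (fun y => w1 (WEF L it v y)) (fun y => w1 (nWEF L it w y)) i)) =
      Fin.append (fun y => decide (y ∈ lcell S v)) (fun y => decide (y ∉ lcell S w)) := by
    funext i
    induction i using Fin.addCases with
    | left i => simp only [Fin.append_left, wire_w1]; exact Bool.eq_iff_iff.2 (by rw [Vl_WEF h, decide_eq_true_iff])
    | right j => simp only [Fin.append_right, wire_w1]; exact Bool.eq_iff_iff.2 (by rw [Vl_nWEF h, decide_eq_true_iff])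
  rw [happ, Literature.Computability.AlgebraicComplexity.LabelledArithCircuit.numOnes_append, numOnes_eq_card, numOnes_eq_card]
  have h1 : (univ.filter fun y => decide (y ∈ lcell S v) = true) = lcell S v := by ext y; simp
  have h2 : (univ.filter fun y => decide (y ∉ lcell S w) = true) = univ \ lcell S w := by ext y; simp
  rw [h1, h2, card_univ_sdiff, Fintype.card_fin]
  have := card_le_univ (lcell S w); rw [Fintype.card_fin] at this
  omega

variable (hn : 2 ≤ n)
include hn

/-- `big v` computes `2 ≤ |lcell v|` (window of at least two vertices). -/
theorem ev_aBig (v : Fin n) : ev x (aBig (r := r) L it v) = decide (2 ≤ (lcell S v).card) := by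
  apply Bool.eq_iff_iff.2
  show Vl K x _ = true ↔ _
  rw [Vl_eq, decide_eq_true_iff]
  show (GateFn.maj (n + n)).2 (fun i => GateDAG.wire x (Vl K x) (cnt n 2 (fun y => w1 (WEF L it v y)) i)) = true ↔ _
  rw [maj_cnt_iff x hn]
  simp only [wire_w1, Vl_WEF h]
  rw [show (univ.filter fun y => y ∈ lcell S v) = lcell S v from by ext; simp]

omit [NeZero n] h hn in
/-- In `W`, the key order of the tree (`(|cell|, colour)` lexicographic) in terms of lifted cells and colours. -/
theorem cellKey_le_iff {v w : Fin n} (hv : v ∈ S.W) (hw : w ∈ S.W) :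
    cellKey S.W S.c v ≤ cellKey S.W S.c w ↔
      ((lcell S v).card < (lcell S w).card ∨ ((lcell S v).card ≤ (lcell S w).card ∧ ¬ S.liftLT w v)) := by
  rw [lcell_eq_cell hv, lcell_eq_cell hw, S.liftLT_of_mem hw hv, cellKey, cellKey, Prod.Lex.le_iff]
  simp only [ofLex_toLex]
  constructor
  · rintro (hlt | ⟨heq, hle⟩)
    · exact Or.inl hlt
    · exact Or.inr ⟨heq.le, not_lt.2 hle⟩
  · rintro (hlt | ⟨hle, hnlt⟩)
    · exact Or.inl hlt
    · rcases (lt_or_eq_of_le hle) with hlt | heq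
      · exact Or.inl hlt
      · exact Or.inr ⟨heq, not_lt.1 hnlt⟩

/-- **`bmc v` computes membership in the branching cell `CGCanon.bigMinCell W c`.** -/
theorem ev_aBmc (v : Fin n) : ev x (aBmc (r := r) L it v) = decide (v ∈ bigMinCell S.W S.c) := by
  apply Bool.eq_iff_iff.2
  show Vl K x _ = true ↔ _
  rw [Vl_eq, decide_eq_true_iff]
  show (GateFn.and (n + 2)).2 (fun i => GateDAG.wire x (Vl K x) (Kind.argsR L .bmc (prm (vec1 v) (it := it)) i)) = true ↔ _
  simp only [GateFn.and, decide_eq_true_iff, Kind.argsR, prm_it, prm_vs, vec1_apply]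
  rw [Fin.forall_fin_add]
  simp only [Fin.append_left, Fin.append_right, Fin.forall_fin_two, Fin.isValue, Fin.val_zero, ↓reduceIte, Fin.val_one,
    one_ne_zero, wire_wA, h.W, ev_aBig h hn, decide_eq_true_eq, wire_w2]
  have haimp : ∀ w : Fin n, Vl K x (.f2 (n2or [litN1 (neg (aW L it w)), litN1 (neg (aBig L it w)), litN1 (neg (aSzGE L it v w)),
      n1and [pos (aSzGE L it w v), neg (aLT L it w v)]])) = true ↔
      (w ∈ S.W → 2 ≤ (lcell S w).card → ((lcell S v).card < (lcell S w).card ∨ ((lcell S v).card ≤ (lcell S w).card ∧ ¬ S.liftLT w v))) := by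
    intro w
    rw [Vl_n2or x _ (by simp)]
    simp only [List.mem_cons, List.not_mem_nil, or_false, exists_eq_or_imp, exists_eq_left, Vl_litN1, holds_neg, h.W,
      ev_aBig h hn, ev_aSzGE h, decide_eq_false_iff_not, not_le]
    rw [Vl_n1and x _ (by simp)]
    simp only [List.mem_cons, List.not_mem_nil, or_false, forall_eq_or_imp, forall_eq, holds_pos, holds_neg, ev_aSzGE h,
      h.LT, decide_eq_true_eq, decide_eq_false_iff_not]
    by_cases hw : w ∈ S.W
    · by_cases h2 : 2 ≤ (lcell S w).card
      · have h2' : ¬ (lcell S w).card < 2 := not_lt.2 h2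
        simp only [hw, not_true_eq_false, false_or, h2, forall_true_left, h2']
      · have h2' : (lcell S w).card < 2 := not_le.1 h2
        simp only [hw, not_true_eq_false, false_or, h2, IsEmpty.forall_iff]
        exact iff_of_true (Or.inl h2') (fun _ => trivial)
    · simp [hw]
  simp only [haimp, mem_bigMinCell]
  constructor
  · rintro ⟨hall, hvW, hbig⟩
    rw [lcell_eq_cell hvW] at hbig
    refine ⟨hvW, hbig, fun w hw hw2 => ?_⟩
    rw [cellKey_le_iff hvW hw]
    exact hall w hw (by rwa [lcell_eq_cell hw])
  · rintro ⟨hvW, hbig, hmin⟩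
    refine ⟨fun w hw hw2 => ?_, hvW, by rwa [lcell_eq_cell hvW]⟩
    rw [← cellKey_le_iff hvW hw]
    exact hmin w hw (by rwa [← lcell_eq_cell hw])

/-! ### Selection -/

/-- **`sel v` computes membership in `selSet`.** -/
theorem ev_aSel (v : Fin n) : ev x (aSel (r := r) L it v) = decide (v ∈ selSet L.1 S) := by
  apply Bool.eq_iff_iff.2
  show Vl K x _ = true ↔ _
  rw [Vl_eq, decide_eq_true_iff]
  show (GateFn.and (n + 2)).2 (fun i => GateDAG.wire x (Vl K x) (Kind.argsR L .sel (prm (vec1 v) (it := it)) i)) = true ↔ _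
  simp only [GateFn.and, decide_eq_true_iff, Kind.argsR, prm_it, prm_vs, vec1_apply]
  rw [Fin.forall_fin_add]
  simp only [Fin.append_left, Fin.append_right, Fin.forall_fin_two, Fin.isValue, Fin.val_zero, ↓reduceIte, Fin.val_one,
    one_ne_zero, wire_wA, ev_aBmc h hn, decide_eq_true_eq]
  have hsimp : ∀ w : Fin n, GateDAG.wire x (Vl K x) (if w ≠ v ∧ w ∈ L.1.X ∧ L.1.lam v ≤ L.1.lam w then
      w1 (n1or [neg (aBmc L it w), pos (aC L it w)]) else wA ttA) = true ↔
      ((w ≠ v ∧ w ∈ L.1.X ∧ L.1.lam v ≤ L.1.lam w) → (w ∉ bigMinCell S.W S.c ∨ w ∈ S.C)) := by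
    intro w
    split_ifs with hc
    · rw [wire_w1, Vl_n1or x _ (by simp)]
      simp [ev_aBmc h hn, h.C, hc]
    · simp [hc]
  have hv2 : GateDAG.wire x (Vl K x) (if v ∈ L.1.X then wN (aC L it v) else wA ffA) = true ↔ (v ∈ L.1.X ∧ v ∉ S.C) := by
    split_ifs with hc <;> simp [h.C, hc]
  simp only [hsimp, hv2, mem_selSet]
  constructor
  · rintro ⟨hall, hbmc, hX, hC⟩
    refine ⟨hbmc, hX, hC, fun w hw hwX hwC hne => ?_⟩
    by_contra hlt
    rcases hall w ⟨hne, hwX, not_lt.1 hlt⟩ with h' | h'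
    · exact h' hw
    · exact hwC h'
  · rintro ⟨hbmc, hX, hC, hmax⟩
    refine ⟨fun w ⟨hne, hwX, hle⟩ => ?_, hbmc, hX, hC⟩
    by_contra hno
    push Not at hno
    exact absurd (hmax w hno.1 hwX hno.2 hne) (not_lt.2 hle)

/-- `hasSel` computes nonemptiness of `selSet`. -/
theorem ev_aHasSel (z : Fin n) : ev x (aHasSel (r := r) L it z) = decide (selSet L.1 S).Nonempty := by
  apply Bool.eq_iff_iff.2
  show Vl K x _ = true ↔ _
  rw [Vl_eq, decide_eq_true_iff]
  show (GateFn.or n).2 (fun i => GateDAG.wire x (Vl K x) (Kind.argsR L .hasSel (prm (vec1 z) (it := it)) i)) = true ↔ _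
  simp only [GateFn.or, decide_eq_true_iff, Kind.argsR, prm_it, wire_wA, ev_aSel h hn]
  exact Iff.rfl

omit hn in
/-- `pok` computes the reachability clause of `pokP`: all of `U` lies in `W` and in one switched-graph component. -/
theorem ev_aPok (z : Fin n) : ev x (aPok (r := r) L it z) =
    decide (∀ u ∈ L.1.U, ∀ u' ∈ L.1.U, u ∈ S.W ∧ (swG (G x) S.W S.c).Reachable u u') := by
  apply Bool.eq_iff_iff.2
  show Vl K x _ = true ↔ _
  rw [Vl_eq, decide_eq_true_iff]
  show (GateFn.and (n * n)).2 (fun i => GateDAG.wire x (Vl K x) (Kind.argsR L .pok (prm (vec1 z) (it := it)) i)) = true ↔ _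
  simp only [GateFn.and, decide_eq_true_iff, Kind.argsR, prm_it, finProdFinEquiv_symm_apply]
  have hw : ∀ i : Fin (n * n), GateDAG.wire x (Vl K x) (if i.divNat ∈ L.1.U ∧ i.modNat ∈ L.1.U then
      wA (aReach L it (Fin.last n) i.divNat i.modNat) else wA ttA) = true ↔
      (i.divNat ∈ L.1.U → i.modNat ∈ L.1.U → reachK x S n i.divNat i.modNat) := by
    intro i
    split_ifs with hc
    · simp [ev_aReach h, hc]
    · simp only [not_and] at hc; simp only [wire_wA, ev_tt, true_iff]; exact fun h1 h2 => absurd h2 (hc h1)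
  simp only [hw]
  constructor
  · intro hall u hu u' hu'
    have := hall (finProdFinEquiv (u, u')) (by simpa using hu) (by simpa using hu')
    simpa [reachK_last_iff] using this
  · intro hall i hu hu'
    exact (reachK_last_iff x).2 (hall _ hu _ hu')

omit hn in
/-- `nWs v` computes membership in `secW`. -/
theorem ev_aNWs (v : Fin n) : ev x (aNWs (r := r) L it v) = decide (v ∈ secW L.1 x S) := by
  apply Bool.eq_iff_iff.2
  show Vl K x _ = true ↔ _
  rw [Vl_eq, decide_eq_true_iff]
  show (GateFn.or n).2 (fun i => GateDAG.wire x (Vl K x) (Kind.argsR L .nWs (prm (vec1 v) (it := it)) i)) = true ↔ _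
  simp only [GateFn.or, decide_eq_true_iff, Kind.argsR, prm_it, prm_vs, vec1_apply]
  have hw : ∀ u : Fin n, GateDAG.wire x (Vl K x) (if u ∈ L.1.U then wA (aReach L it (Fin.last n) u v) else wA ffA) = true ↔
      (u ∈ L.1.U ∧ reachK x S n u v) := by
    intro u; split_ifs with hc <;> simp [ev_aReach h, hc]
  simp only [hw, secW, mem_filter, reachK_last_iff]
  constructor
  · rintro ⟨u, hu, huW, hr⟩; exact ⟨mem_of_reachable huW hr, u, hu, huW, hr⟩
  · rintro ⟨-, u, hu, huW, hr⟩; exact ⟨u, hu, huW, hr⟩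

end WCan

end Summit.PneNP.PneNP.Theorems

end
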